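import Literature.Probability.DuminilCopinMarkarPanisSlade2026.ErrorTermFloor
import Literature.Barriers.CriticalPhenomena.GaussianDominationRoute
import Literature.Probability.FitznerVanDerHofstad2017.MeanFieldExponents
import HarnessLib

/-!
# Duminil-Copin–Markar–Panis–Slade (2026), nearest-neighbour percolation: the DOOR itself as a
# kernel theorem — what the black box would give at tolerance `δ`, the key it needs, and why the
# paper's key does not fit

CITATION HEADER. Source: H. Duminil-Copin, A. Markar, R. Panis, G. Slade, *A random walk approach
to high-dimensional critical phenomena*, arXiv:2605.21438v2 (21 May 2026), 85 pp., UNREFEREED (bib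
key `DuminilCopinMarkarPanisSlade2026RandomWalk`; held as `lit paper:arxiv-2605.21438`; page numbers =
PDF pages of v2). Origin: build `lace`, unit `b2b-lace-dmps-g3` (third generation of the "DMPS route"
seat: is the random-walk black box a second, lace-free door to mean-field nearest-neighbour
percolation at `d = 10, 11`?). Companions: `…DuminilCopinMarkarPanisSlade2026.BlackBox` (the paper's
Definitions 1.1/1.3, Assumptions I–II, Theorems 1.5–1.7, Proposition 4.1 as `Prop`s; the
nearest-neighbour dictionary `nnKernel`, `Gperc`, `Hperc`, `betaCPerc`), `…NearestNeighbourVerdict`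
(the verdict `not_percolationAssumptionII`: Assumption II FAILS for the nearest-neighbour model at every
`δ ≤ 1/(2d)`, in particular at the paper's constructed `𝛅 ≤ 2⁻⁹`), `…ErrorTermFloor` (Prop. 4.1
junk-free, the floor `E ≥ 1 - 1/β`).

WHY THIS FILE. The two earlier modules close the door AS PRINTED. What was still prose (the build's
GAPS G14: "a near-critical criterion of DMPS type whose tolerance for `E` is `≳ 1/(2d)` does not exist
in print; producing one is a change of mechanism") is typed here as ONE conditional theorem with an
explicit missing hypothesis, so that the "second door" has the same shape as the lace rung
`percolationContinuity_of_laceBootstrap d`: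

  DOOR (`percolationContinuity_of_theorem16Conclusion`, `d ≥ 3`): the conclusion of DMPS Theorem 1.6
  at ratio constant `c₀ = 1` and tolerance `δ` (`Theorem16Conclusion d 1 c C ε δ`, any `c, C ≥ 0`,
  `ε < d - 2`) ∧ "nearest-neighbour percolation obeys Def. 1.3 + Assumption I with the `H` of (6.40)"
  (`PercolationAssumptionI d`, DMPS §6.3) ∧ Assumption II at `δ` ⟹ `θ(p_c) = 0` on `ℤ^d`
  (`PercolationContinuity d`); and with the conclusion of Theorem 1.7 (`Theorem17Conclusion d 1 δ`)
  also `γ = 1` in the bounded-ratio sense (`GammaEqOneBoundedRatio d`, with the explicit constants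
  `c₁ = 1/(2d)`, `c₂ = (1/(2d))(1 + 1/(1-E))` read off (1.28)).
  MECHANISM: (1.26) for every `β < β_c` is an `x`-space power bound `τ_p(0,x) ≤ C‖x‖^{-(d-2-ε)}`
  uniform in `p < p_c` (`tau_le_rpow_of_theorem16Conclusion`), and ANY such bound with a positive
  exponent kills `θ(p_c)` (the tree's `percolationContinuity_of_tau_le_rpow_subcrit`, Heydenreich–van der
  Hofstad p. 48: `θ(p_c)² ≤ τ_{p_c}(0,x) → 0`). No triangle condition, no smallness is used at this step.

  KEY (`NNErrorTermBelow d δ`): "`E_NN(d) < δ`" typed junk-free — some `η < δ` bounds the summand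
  `‖H_t‖₁ + ‖|x|₂² H_t‖₁/ξ(t)²` of (1.23) for EVERY `t ∈ [0, β_c)`, where for percolation `‖H_t‖₁` is
  the open triangle `(G_t ∗ G_t ∗ F_t)(0)` ((6.192) p. 69). It implies Assumption II at `δ` outright
  (`percolationAssumptionII_of_nnErrorTermBelow`) and, granted the door theorem (`β(δ) = β_c`), is
  EQUIVALENT to it (`nnErrorTermBelow_iff`).

  LOCK (kernel, two independent paths): whatever `δ` turns the key satisfies `δ > 1/(2d)` — from
  the door's own Theorem-1.7 hypothesis (`dmpsDoor_delta_gt`, via `not_percolationAssumptionII`: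
  (1.27) `β_c ≤ 1/(1-E)` against `β_c ≥ 2d/(2d-1)`), or from Proposition 4.1 alone
  (`inv_two_mul_lt_of_nnErrorTermBelow`, via `ErrorTermFloor`); the paper's key is `𝛅 ≤ δ_reg = 2⁻⁹`
  (`Theorem15AsConstructed`), which is `≤ 1/(2d)` for every `d ≤ 256` (`deltaReg_le_inv_two_mul`) — so
  `no_key_asConstructed`. The unit's two-engine census puts the true size of the key at
  `E_NN(11) ≥ 0.1452`, `E_NN(10) ≥ 0.1608` rigorously (open-triangle shells) and `≈ 0.25 – 0.35` at
  mean-field level (HOME/b2b-lace-dmps-g3/): a Theorem 1.6 with tolerance of that order — a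
  NON-PERTURBATIVE effective-random-walk bootstrap — is the theorem-shaped gap. The paper itself:
  "our method requires `Σ_x H_β(x)` to be not merely finite, but also small" (p. 7). Spelled out at
  the lace ladder's first open rung and floor: `dmpsDoor_d10` (`δ > 1/20`), `dmpsDoor_d11` (`δ > 1/22`).

ABSOLUTE RULE respected: nothing of DMPS is asserted. `Theorem16Conclusion`/`Theorem17Conclusion` at a
`δ > 1/(2d)` are NOT theorems of the paper (it proves them for its `𝛅 ≤ 2⁻⁹` only) — they enter as
hypotheses `(h : X)` and are exactly what a second door would have to supply; `PercolationAssumptionI d`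
is DMPS's §6.3 claim (Hutchcroft [49, Lemma 2.4] for (I.1); Aizenman–Newman [6] / Slade [82, Prop. 9.11]
for (I.2)), also a hypothesis. Kernel-proved here: the nearest-neighbour bookkeeping (`p = β/(2d)`,
`σ_J = 1`, `‖x‖_∞ ≥ 1` off the origin), the passage (1.26) ⟹ `x`-space power bound ⟹ `θ(p_c) = 0`,
(1.28) ⟹ `γ = 1` bounded ratio, and the lock.
-/

noncomputable section

open Filter
open _root_.Topology

namespace Literature.Probability.DuminilCopinMarkarPanisSlade2026

open Literature.Probability.LatticeModels (Site zdGraph)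
open Literature.Probability.Percolation
open Literature.Probability.FitznerVanDerHofstad2017 (GammaEqOneBoundedRatio)

variable {d : ℕ}

/-! ## The key: `E_NN(d) < δ`, junk-free -/

/-- **The key the DMPS door needs for nearest-neighbour percolation at tolerance `δ`**:
"`E(β_c) < δ`" for the nearest-neighbour kernel `J = (2d)⁻¹ 1_{|x|₂=1}`, `G_β = τ_{β/(2d)}` and the
`H_β = (G_β ∗ J ∗ G_β)·G_β` of (6.40), typed junk-free (no `sSup`): some `η < δ` bounds the summand
`‖H_t‖₁ + ‖|x|₂² H_t‖₁/ξ(t)²` of the error term (1.23) at every `t ∈ [0, β_c)`. For percolation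
`‖H_t‖₁ = (G_t ∗ G_t ∗ F_t)(0)` is the open triangle diagram ((6.192), p. 69).
[cite: DuminilCopinMarkarPanisSlade2026RandomWalk, (1.23) p. 8 and Thm. 1.7 p. 9 (E = E(β_c) < 𝛅)] -/
def NNErrorTermBelow (d : ℕ) (δ : ℝ) : Prop :=
  ∃ η : ℝ, η < δ ∧ ∀ t : ℝ, 0 ≤ t → t < betaCPerc d →
    errSummand (nnKernel d) (Gperc d) (Hperc d) t ≤ η

/-- The key opens Assumption II at `δ` (whatever `β(δ) ≤ β_c` is: the bound is asked on the smaller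
range `[0, β(δ)] ∩ [0, β_c)`). [folklore] -/
theorem percolationAssumptionII_of_nnErrorTermBelow {δ : ℝ} (h : NNErrorTermBelow d δ) :
    PercolationAssumptionII d δ := by
  obtain ⟨η, hηδ, hη⟩ := h
  exact ⟨η, hηδ, fun t ht0 _ htc => hη t ht0 htc⟩

/-- Conversely, once `β(δ) = β_c` (the first conclusion of Theorem 1.6), Assumption II at `δ` IS the
key. [folklore] -/
theorem nnErrorTermBelow_of_betaOf_eq {δ : ℝ}
    (hβ : betaOf (betaCPerc d) (nnKernel d) (Gperc d) (Hperc d) δ = betaCPerc d)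
    (hII : PercolationAssumptionII d δ) : NNErrorTermBelow d δ := by
  obtain ⟨η, hηδ, hη⟩ := hII
  exact ⟨η, hηδ, fun t ht0 htc => hη t ht0 (by rw [hβ]; exact htc.le) htc⟩

/-- Under the conclusion of Theorem 1.6 at `(c₀ = 1; c, C; ε; δ)` and DMPS §6.3 (percolation obeys
Def. 1.3 + Assumption I), the key `E_NN(d) < δ` and Assumption II at `δ` are equivalent (`d ≥ 1`).
[folklore] -/
theorem nnErrorTermBelow_iff (hd : 1 ≤ d) {c C ε δ : ℝ} (h16 : Theorem16Conclusion d 1 c C ε δ)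
    (hI : PercolationAssumptionI d) (hd2 : 2 ≤ d) :
    NNErrorTermBelow d δ ↔ PercolationAssumptionII d δ := by
  refine ⟨percolationAssumptionII_of_nnErrorTermBelow, fun hII => ?_⟩
  obtain ⟨hG, hAI⟩ := hI hd2
  obtain ⟨hβ, -⟩ := h16 (betaCPerc d) (nnKernel d) (Gperc d) (Hperc d) (nnKernel_admissible hd)
    (kernelRatio_nnKernel hd) hG hAI hII
  exact nnErrorTermBelow_of_betaOf_eq hβ hII

/-! ## The lock: any key exceeds `1/(2d)`; the paper's key (`𝛅 ≤ 2⁻⁹`) does not -/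

/-- **The lock.** If nearest-neighbour percolation obeys Def. 1.3 + Assumption I (DMPS §6.3) and
Proposition 4.1 holds (Assumption I only, p. 25), then any `δ` with `E_NN(d) < δ` satisfies
`δ > 1/(2d)`: by `exists_errSummand_Hperc_gt` the summand exceeds every `η < 1/(2d)` somewhere below
`β_c` (`E(β) ≥ 1 - 1/β` and `β_c = 2d·p_c ≥ 2d/(2d-1)`). [folklore] -/
theorem inv_two_mul_lt_of_nnErrorTermBelow (hd : 2 < d) (h41 : Proposition41Eta d)
    (hI : PercolationAssumptionI d) {δ : ℝ} (h : NNErrorTermBelow d δ) : 1 / (2 * d : ℝ) < δ := by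
  obtain ⟨η, hηδ, hη⟩ := h
  by_contra hle
  push Not at hle
  obtain ⟨t, ht0, htc, hηt⟩ := exists_errSummand_Hperc_gt hd h41 hI (lt_of_lt_of_le hηδ hle)
  have := hη t ht0 htc
  linarith

/-- Hence no `δ ≤ 1/(2d)` is a key; in particular (`deltaReg_le_inv_two_mul`) the paper's own
`𝛅 ≤ δ_reg = 2⁻⁹` is not, for any `3 ≤ d ≤ 256`. [folklore] -/
theorem not_nnErrorTermBelow (hd : 2 < d) (h41 : Proposition41Eta d) (hI : PercolationAssumptionI d)
    {δ : ℝ} (hδ : δ ≤ 1 / (2 * d)) : ¬ NNErrorTermBelow d δ :=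
  fun h => absurd (inv_two_mul_lt_of_nnErrorTermBelow hd h41 hI h) (not_lt.mpr hδ)

/-- The paper's key does not fit the nearest-neighbour lock: for `3 ≤ d ≤ 256`, no `δ ≤ δ_reg = 2⁻⁹`
(the range in which the proof of Theorem 1.5 delivers `𝛅`, `Theorem15AsConstructed`) satisfies
`E_NN(d) < δ`. [folklore] -/
theorem no_key_asConstructed (hd : 2 < d) (hd' : d ≤ 256) (h41 : Proposition41Eta d)
    (hI : PercolationAssumptionI d) {δ : ℝ} (hδ : δ ≤ deltaReg) : ¬ NNErrorTermBelow d δ :=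
  not_nnErrorTermBelow hd h41 hI (hδ.trans (deltaReg_le_inv_two_mul (by omega) hd'))

/-! ## Nearest-neighbour bookkeeping -/

/-- For `p ∈ [0,1]`, the DMPS parameter `β = 2d·p` has bond density `p`: `percParam d (2d·p) = p`.
[folklore] -/
theorem percParam_two_mul (hd : 1 ≤ d) (p : unitInterval) : percParam d (2 * d * (p : ℝ)) = p := by
  have hdR : (0 : ℝ) < d := by exact_mod_cast hd
  have hp0 : 0 ≤ (p : ℝ) := p.2.1
  have hp1 : (p : ℝ) ≤ 1 := p.2.2
  apply Subtype.ext
  rw [coe_percParam hd (by positivity) (by nlinarith)]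
  field_simp

/-- `G_{2d·p} = τ_p(0,·)`. [folklore] -/
theorem Gperc_two_mul (hd : 1 ≤ d) (p : unitInterval) (x : Site d) :
    Gperc d (2 * d * (p : ℝ)) x = tau d p 0 x := by
  unfold Gperc
  rw [percParam_two_mul hd p]

/-- `p < p_c` iff `2d·p < β_c = 2d·p_c` (the direction used). [folklore] -/
theorem two_mul_lt_betaCPerc (hd : 1 ≤ d) {p : unitInterval}
    (hp : (p : ℝ) < criticalProb (zdGraph d) (0 : Site d)) : 2 * d * (p : ℝ) < betaCPerc d := by
  have hdR : (0 : ℝ) < d := by exact_mod_cast hd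
  unfold betaCPerc
  rw [coe_criticalProbI]
  exact mul_lt_mul_of_pos_left hp (by positivity)

/-! ## The door: (1.26) on `[0, β_c)` ⟹ `x`-space power bound ⟹ `θ(p_c) = 0` -/

/-- **(1.26) for every `β < β_c` is an `x`-space power bound uniform in `p < p_c`.** Under the
conclusion of Theorem 1.6 at `(c₀ = 1; c, C; ε; δ)` with `c, C ≥ 0`, DMPS §6.3 for the
nearest-neighbour model, and Assumption II at `δ`: for every `p < p_c` and `x ≠ 0`,
`τ_p(0,x) ≤ C ‖x‖_∞^{-(d-2-ε)}` — since `σ_J = 1` (`sigma_nnKernel`), `δ₀(x) = 0`, `1 ∨ |x| = |x|`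
and `exp(-c|x|/ξ(β)) ≤ 1`. [cite: DuminilCopinMarkarPanisSlade2026RandomWalk, Thm. 1.6 p. 9 with (1.26) p. 8] -/
theorem tau_le_rpow_of_theorem16Conclusion (hd : 2 ≤ d) {c C ε δ : ℝ} (hc : 0 ≤ c) (hC : 0 ≤ C)
    (h16 : Theorem16Conclusion d 1 c C ε δ) (hI : PercolationAssumptionI d)
    (hII : PercolationAssumptionII d δ) :
    ∀ p : unitInterval, (p : ℝ) < criticalProb (zdGraph d) (0 : Site d) →
      ∀ x : Site d, x ≠ 0 → tau d p 0 x ≤ C * ‖x‖ ^ (-((d : ℝ) - 2 - ε)) := by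
  intro p hp x hx
  have hd1 : 1 ≤ d := by omega
  obtain ⟨hG, hAI⟩ := hI hd
  obtain ⟨-, hMB⟩ := h16 (betaCPerc d) (nnKernel d) (Gperc d) (Hperc d) (nnKernel_admissible hd1)
    (kernelRatio_nnKernel hd1) hG hAI hII
  set β : ℝ := 2 * d * (p : ℝ) with hβdef
  have hβ0 : 0 ≤ β := by
    have : 0 ≤ (p : ℝ) := p.2.1
    positivity
  have hβc : β < betaCPerc d := two_mul_lt_betaCPerc hd1 hp
  -- `1 ≤ ‖x‖_∞` off the origin (as `LongRangeIsing.one_le_norm_of_ne_zero`, inlined to keep the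
  -- long-range-Ising integral machinery out of this module's imports)
  have hx1 : (1 : ℝ) ≤ ‖x‖ := by
    obtain ⟨j, hj⟩ := Function.ne_iff.mp hx
    have h1 : (1 : ℝ) ≤ |((x j : ℤ) : ℝ)| := by
      rw [← Int.cast_abs]
      exact_mod_cast Int.one_le_abs hj
    exact h1.trans ((Int.norm_eq_abs (x j)).symm.trans_le (norm_le_pi_norm x j))
  have hxpos : (0 : ℝ) < ‖x‖ := lt_of_lt_of_le one_pos hx1
  have h := hMB β hβ0 hβc x
  rw [hβdef, Gperc_two_mul hd1 p x] at h
  have hδ0 : delta0 x = 0 := by simp [delta0, hx]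
  rw [hδ0, zero_add, sigma_nnKernel hd1, one_pow, div_one, max_eq_right hx1, one_div,
    Real.inv_rpow hxpos.le, ← Real.rpow_neg hxpos.le] at h
  refine h.trans ?_
  have hexp : Real.exp (-(c * ‖x‖ / xi (nnKernel d) (Gperc d) (2 * d * (p : ℝ)))) ≤ 1 := by
    rw [Real.exp_le_one_iff, neg_nonpos]
    exact div_nonneg (mul_nonneg hc (norm_nonneg _)) (Real.sqrt_nonneg _)
  have hmain : 0 ≤ C * ‖x‖ ^ (-((d : ℝ) - 2 - ε)) := mul_nonneg hC (Real.rpow_nonneg hxpos.le _)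
  calc C * ‖x‖ ^ (-((d : ℝ) - 2 - ε)) * Real.exp (-(c * ‖x‖ / xi (nnKernel d) (Gperc d) (2 * d * (p : ℝ))))
      ≤ C * ‖x‖ ^ (-((d : ℝ) - 2 - ε)) * 1 := mul_le_mul_of_nonneg_left hexp hmain
    _ = C * ‖x‖ ^ (-((d : ℝ) - 2 - ε)) := mul_one _

/-- **THE DOOR (continuity).** For `d ≥ 3`: the conclusion of DMPS Theorem 1.6 at ratio constant
`c₀ = 1`, constants `c, C ≥ 0`, exponent loss `ε < d - 2` and tolerance `δ`, together with DMPS §6.3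
(nearest-neighbour percolation obeys Def. 1.3 + Assumption I with the `H` of (6.40)) and Assumption II
at `δ`, gives `θ(p_c) = 0` for nearest-neighbour bond percolation on `ℤ^d` — via the `x`-space power
bound `τ_p(0,x) ≤ C‖x‖^{-(d-2-ε)}` uniform in `p < p_c` and the tree's criterion
`percolationContinuity_of_tau_le_rpow_subcrit` (`θ(p_c)² ≤ τ_{p_c}(0,x) → 0`). The paper proves the
first hypothesis only for its `𝛅 ≤ 2⁻⁹`, at which the third FAILS (`not_percolationAssumptionII`);
a Theorem 1.6 with tolerance `δ > E_NN(d)` (`≥ 1/(2d)`, `no_key_asConstructed`; `≈ 0.25–0.35` by the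
unit's census) is the missing, non-perturbative theorem.
[cite: DuminilCopinMarkarPanisSlade2026RandomWalk, Thm. 1.6 p. 9; §6.3 pp. 47–49] [cite: HeydenreichVanDerHofstad2017, p. 48 ((1.2.14) ⟹ θ(p_c) = 0)] -/
theorem percolationContinuity_of_theorem16Conclusion (hd : 3 ≤ d) {c C ε δ : ℝ} (hc : 0 ≤ c)
    (hC : 0 ≤ C) (hε : ε < (d : ℝ) - 2) (h16 : Theorem16Conclusion d 1 c C ε δ)
    (hI : PercolationAssumptionI d) (hII : PercolationAssumptionII d δ) : PercolationContinuity d :=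
  Literature.Barriers.CriticalPhenomena.percolationContinuity_of_tau_le_rpow_subcrit (by omega)
    (a := (d : ℝ) - 2 - ε) (C := C) (by linarith)
    (tau_le_rpow_of_theorem16Conclusion (by omega) hc hC h16 hI hII)

/-- The door with the KEY in place of Assumption II: Theorem 1.6-conclusion ∧ §6.3 ∧ `E_NN(d) < δ`
⟹ `θ(p_c) = 0` (`d ≥ 3`). [folklore] -/
theorem percolationContinuity_of_key (hd : 3 ≤ d) {c C ε δ : ℝ} (hc : 0 ≤ c) (hC : 0 ≤ C)
    (hε : ε < (d : ℝ) - 2) (h16 : Theorem16Conclusion d 1 c C ε δ) (hI : PercolationAssumptionI d)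
    (hkey : NNErrorTermBelow d δ) : PercolationContinuity d :=
  percolationContinuity_of_theorem16Conclusion hd hc hC hε h16 hI
    (percolationAssumptionII_of_nnErrorTermBelow hkey)

/-! ## The door: (1.28) ⟹ `γ = 1` in the bounded-ratio sense -/

/-- **THE DOOR (`γ = 1`).** For `d ≥ 2`: the conclusion of DMPS Theorem 1.7 at ratio constant
`c₀ = 1` and tolerance `δ`, DMPS §6.3 for the nearest-neighbour model, and Assumption II at `δ` give
`γ = 1` in the bounded-ratio sense of Fitzner–van der Hofstad (1.7): (1.28)
"`1/(β_c-β) ≤ χ(β) ≤ (1/(1-E))·1/(β_c-β)`" with `β = 2d·p`, `β_c = 2d·p_c` reads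
`(1/(2d))/(p_c-p) ≤ χ(p) ≤ (1/(2d))(1/(1-E))/(p_c-p)` for every `p < p_c` (`E = E(β_c) < δ`, and
`1 - E > 0` because `1 ≤ β_c ≤ 1/(1-E)`, (1.27)); the extra hypothesis `χ(β_c) = ∞` of Theorem 1.7 is
the tree's `tendsto_chi_Gperc`. [cite: DuminilCopinMarkarPanisSlade2026RandomWalk, Thm. 1.7 (1.27)–(1.28) p. 9] [cite: FitznerVanDerHofstad2017, (1.7) with (1.6), EJP p. 4] -/
theorem gammaEqOneBoundedRatio_of_theorem17Conclusion (hd : 2 ≤ d) {δ : ℝ}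
    (h17 : Theorem17Conclusion d 1 δ) (hI : PercolationAssumptionI d)
    (hII : PercolationAssumptionII d δ) : GammaEqOneBoundedRatio d := by
  have hd1 : 1 ≤ d := by omega
  have hdR : (0 : ℝ) < d := by exact_mod_cast (show 0 < d by omega)
  obtain ⟨hG, hAI⟩ := hI hd
  obtain ⟨-, h1, hβcE, hall⟩ := h17 (betaCPerc d) (nnKernel d) (Gperc d) (Hperc d)
    (nnKernel_admissible hd1) (kernelRatio_nnKernel hd1) hG hAI hII (tendsto_chi_Gperc hd)
  set E := errEc (betaCPerc d) (nnKernel d) (Gperc d) (Hperc d) with hEdef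
  -- `1 - E > 0` from `1 ≤ β_c ≤ 1/(1-E)`
  have h1E : 0 < 1 - E := by
    by_contra hle
    push Not at hle
    have : 1 / (1 - E) ≤ 0 := div_nonpos_of_nonneg_of_nonpos zero_le_one hle
    linarith
  set c₁ : ℝ := 1 / (2 * d) with hc₁
  set c₂ : ℝ := 1 / (2 * d) * (1 / (1 - E)) + 1 / (2 * d) with hc₂
  have hc₁pos : 0 < c₁ := by rw [hc₁]; positivity
  have hmid : 0 < 1 / (2 * d) * (1 / (1 - E)) := by positivity
  refine ⟨c₁, c₂, 1, hc₁pos, by rw [hc₂, hc₁]; linarith, one_pos, fun p _ hp => ?_⟩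
  set β : ℝ := 2 * d * (p : ℝ) with hβdef
  have hβ0 : 0 ≤ β := by
    have : 0 ≤ (p : ℝ) := p.2.1
    positivity
  have hβc : β < betaCPerc d := two_mul_lt_betaCPerc hd1 hp
  obtain ⟨hlo, hhi, -⟩ := hall β hβ0 hβc
  have hchi : chi (Gperc d) β = Percolation.chi d p := by
    rw [chi_Gperc, hβdef, percParam_two_mul hd1 p]
  have hgap : betaCPerc d - β = 2 * d * (criticalProb (zdGraph d) (0 : Site d) - p) := by
    rw [hβdef]; unfold betaCPerc; rw [coe_criticalProbI]; ring
  have hpos : 0 < criticalProb (zdGraph d) (0 : Site d) - p := sub_pos.mpr hp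
  rw [hchi, hgap] at hlo hhi
  have hlo' : c₁ / (criticalProb (zdGraph d) (0 : Site d) - p) = 1 / (2 * d * (criticalProb (zdGraph d) (0 : Site d) - p)) := by
    rw [hc₁]; field_simp
  refine ⟨by rw [hlo']; exact hlo, hhi.trans ?_⟩
  have hrew : 1 / (1 - E) * (1 / (2 * d * (criticalProb (zdGraph d) (0 : Site d) - p))) =
      (1 / (2 * d) * (1 / (1 - E))) / (criticalProb (zdGraph d) (0 : Site d) - p) := by
    field_simp
  rw [hrew]
  exact div_le_div_of_nonneg_right (by rw [hc₂]; linarith [hc₁pos]) hpos.le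

/-- **THE DOOR, both leaves.** For `d ≥ 3`: the conclusions of DMPS Theorems 1.6 and 1.7 at
`(c₀ = 1; c, C ≥ 0; ε < d - 2; δ)`, DMPS §6.3 for the nearest-neighbour model, and the key
`E_NN(d) < δ` give `θ(p_c) = 0` and `γ = 1` (bounded ratio) for nearest-neighbour bond percolation
on `ℤ^d`. With the lock (`inv_two_mul_lt_of_nnErrorTermBelow`): only a `δ > 1/(2d)` can occur here,
whereas the paper's Theorems 1.5–1.7 come with `𝛅 ≤ 2⁻⁹` (`Theorem15AsConstructed`,
`no_key_asConstructed`). This is the exact theorem-shaped gap between arXiv:2605.21438v2 and a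
second, lace-free proof of mean-field behaviour for `d = 10, 11`. [folklore] -/
theorem dmpsDoor (hd : 3 ≤ d) {c C ε δ : ℝ} (hc : 0 ≤ c) (hC : 0 ≤ C) (hε : ε < (d : ℝ) - 2)
    (h16 : Theorem16Conclusion d 1 c C ε δ) (h17 : Theorem17Conclusion d 1 δ)
    (hI : PercolationAssumptionI d) (hkey : NNErrorTermBelow d δ) :
    PercolationContinuity d ∧ GammaEqOneBoundedRatio d :=
  ⟨percolationContinuity_of_key hd hc hC hε h16 hI hkey,
    gammaEqOneBoundedRatio_of_theorem17Conclusion (by omega) h17 hI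
      (percolationAssumptionII_of_nnErrorTermBelow hkey)⟩

/-- **The door carries its own lock.** Under the hypotheses of `dmpsDoor` that concern Theorem 1.7
(its conclusion at `c₀ = 1`, tolerance `δ`) and §6.3, the key `E_NN(d) < δ` forces `δ > 1/(2d)`
(`d ≥ 2`; by `not_percolationAssumptionII`: (1.27) gives `β_c ≤ 1/(1-E)` with `E < δ`, against
`β_c ≥ 2d/(2d-1)`). No Proposition 4.1 needed on this path. [folklore] -/
theorem dmpsDoor_delta_gt (hd : 2 ≤ d) {δ : ℝ} (h17 : Theorem17Conclusion d 1 δ)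
    (hI : PercolationAssumptionI d) (hkey : NNErrorTermBelow d δ) : 1 / (2 * d : ℝ) < δ := by
  by_contra hle
  push Not at hle
  exact not_percolationAssumptionII hd hle h17 hI (percolationAssumptionII_of_nnErrorTermBelow hkey)

/-- The door at the first open rung `d = 10` of the lace ladder, spelled out: a Theorem 1.6/1.7 at
tolerance `δ` plus §6.3 plus the key `E_NN(10) < δ` give `θ(p_c) = 0` and `γ = 1` on `ℤ^{10}` — and
any such `δ` exceeds `1/20 = 0.05` (paper: `𝛅 ≤ 2⁻⁹ ≈ 0.00195`; census: `E_NN(10) ≥ 0.1608`).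
[folklore] -/
theorem dmpsDoor_d10 {c C ε δ : ℝ} (hc : 0 ≤ c) (hC : 0 ≤ C) (hε : ε < 8)
    (h16 : Theorem16Conclusion 10 1 c C ε δ) (h17 : Theorem17Conclusion 10 1 δ)
    (hI : PercolationAssumptionI 10) (hkey : NNErrorTermBelow 10 δ) :
    PercolationContinuity 10 ∧ GammaEqOneBoundedRatio 10 ∧ (1 : ℝ) / 20 < δ := by
  obtain ⟨h1, h2⟩ := dmpsDoor (d := 10) (by norm_num) hc hC (by norm_num; linarith) h16 h17 hI hkey
  have h3 := dmpsDoor_delta_gt (d := 10) (by norm_num) h17 hI hkey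
  norm_num at h3
  exact ⟨h1, h2, h3⟩

/-- The door at the lace ladder's floor `d = 11`, spelled out (any admissible `δ` exceeds
`1/22 ≈ 0.04545`; paper: `𝛅 ≤ 2⁻⁹`; census: `E_NN(11) ≥ 0.1452`). [folklore] -/
theorem dmpsDoor_d11 {c C ε δ : ℝ} (hc : 0 ≤ c) (hC : 0 ≤ C) (hε : ε < 9)
    (h16 : Theorem16Conclusion 11 1 c C ε δ) (h17 : Theorem17Conclusion 11 1 δ)
    (hI : PercolationAssumptionI 11) (hkey : NNErrorTermBelow 11 δ) :
    PercolationContinuity 11 ∧ GammaEqOneBoundedRatio 11 ∧ (1 : ℝ) / 22 < δ := by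
  obtain ⟨h1, h2⟩ := dmpsDoor (d := 11) (by norm_num) hc hC (by norm_num; linarith) h16 h17 hI hkey
  have h3 := dmpsDoor_delta_gt (d := 11) (by norm_num) h17 hI hkey
  norm_num at h3
  exact ⟨h1, h2, h3⟩

end Literature.Probability.DuminilCopinMarkarPanisSlade2026

end
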